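import Mathlib
import HarnessLib.Audit
import Summits.ValiantsHypothesis.ValiantsHypothesis.Theorems.LacunarySymmetroidMatrixDescartesCensusMatrixSignRule

/-!
# The matrix sign rule `z⁺ ≤ n·α` already fails at degree 16 with five honest letters (`n = 2`, `α = 2`, `z⁺ ≥ 6`)

T. R. Cameron and P. J. Psarrakos, *On Descartes' rule of signs for matrix polynomials*, Operators and
Matrices 13 (2019) 643–652 [cite: CameronPsarrakos2019, inequality (6), conjecture at the end of §2 and in §5]
conjecture `z⁺(P) ≤ n·α(P)` for every self-adjoint matrix polynomial whose coefficients are positive definite,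
negative definite or null (class 𝕊), and PROVE it for degree `≤ 3` (their Theorem 7) and for hyperbolic or
congruence-diagonalisable members (Theorem 3, Proposition 4).  The tree already refutes the conjecture
(`SignRule.not_matrixDescartesRule`, a degree-67 member of 𝕊 with seven letters, two of them regularised by
`10⁻¹²`-size diagonal entries).

This file gives a SECOND, STRUCTURALLY MINIMAL witness (no new definitions; the tree's `InClassS`, `alternations`,
`matPoly`, `posEig`, `MatrixDescartesRule` are reused): degree 16, five letters
`D₀ + D₇ x⁷ − K x⁸ + D₉ x⁹ + D₁₆ x¹⁶` with `D₀ = diag(73/2500, 402)`, `D₇ = diag(437/500, 391/50)`,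
`D₉ = diag(1, 14/125)`, `D₁₆ = diag(287/10⁷, 13/(6.25·10⁹))` positive definite DIAGONAL and ONE negative definite
letter `−K`, `K = [[19/10, 161/100], [161/100, 19/10]]` (eigenvalues `351/100`, `29/100`), sign pattern
`+ + − + +` (`α = 2`, `n·α = 4`), whose determinant changes sign between the seven rational points
`9/10, 1, 3/2, 2, 5, 7, 8`; hence `z⁺ ≥ 6 > 4` (`exists_classS_degree16_six`, `not_matrixDescartesRule_deg16`).
An exact Sturm count (seat tool `exp/k3exact.py`) gives exactly six positive eigenvalues
`x ≈ 0.983, 1.146, 1.747, 4.471, 6.896, 7.884`, all simple.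

MECHANISM (why it exists; paper, this seat): with `x = e^{t/4}`, `x⁻⁸ P(x) = diag(a(t), b(t)) − K` where `a, b`
are four-term positive exponential sums (rates `±1/4, ±2`).  Each of `a − 19/10`, `b − 19/10` is convex in `t`
with one sharp dip to a small positive minimum (at two different times) and between the dips the fast/slow rates
switch; `det = (a − k)(b − k) − c²` then dips below `0` on THREE disjoint `t`-intervals.  For `n = 2` the Rayleigh
surface `{(u, t) : uᵀ P u = 0}` consists of disjointly stacked loops, one per excursion of `det < 0`, each carrying
exactly one positive-type and one negative-type eigenvalue, so `z⁺ = 2 · #excursions` is unbounded in 𝕊 at fixed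
`n = 2` as the number of letters grows.

HONEST FRAMING (seat val-sym-lift-p2 g11, cell pub-symmetroid, 2026-08-28).  A helper row for the REAL side of
`stmt-ValiantsHypothesis-19561` (α register of the static definite tridiagonal row): the vertex gauge of that row
is an exponential pencil `Σ_k e^{e_k t} E_kk − J₀` with ONE non-semidefinite letter, and the located heuristics
«one indefinite letter ⇒ Z ≤ 2m» (matrix sign rule with `α = 2`) and «at most `n` zeros of each sign type»
(equivalently «positive-type kernel vectors are independent», lift-p3 g9 §7 (LI)) are both FALSE off the
MONOMIAL-diagonal class — already for `n = 2`, with a positive definite `K`, and with diagonal positive definite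
letters.  What the example does NOT have is one monomial per diagonal entry: a linear law for the α row must use
that (pivot log-concavity, `…StaticTridiagonalPivotLogConcave`), not letter signs.  Nothing here bears on
`WeakLifting` / `TropicalB` in their windows, Conjecture B, the Door-A registers, `MatrixDescartes`
(stmt-ValiantsHypothesis-18050) or VP ≠ VNP; it is not census news (`ζ_sym(2,5) = 14 ≥ 6`).
-/

set_option linter.dupNamespace false

namespace Summit.ValiantsHypothesis.ValiantsHypothesis.Theorems.LacunarySymmetroidMatrixDescartes.SignRule

open Polynomial Matrix Finset

/-- The determinant of the degree-16 witness as an explicit real function (product of the two diagonal letter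
sums minus the square of the off-diagonal one). [data of this seat] -/
theorem det_eval_witness16 (t : ℝ) :
    (matPoly (![0, 7, 8, 9, 16] : Fin 5 → ℕ)
      (![Matrix.diagonal ![73 / 2500, 402], Matrix.diagonal ![437 / 500, 391 / 50],
         -!![19 / 10, 161 / 100; 161 / 100, 19 / 10], Matrix.diagonal ![1, 14 / 125],
         Matrix.diagonal ![287 / 10000000, 13 / 6250000000]] : Fin 5 → Matrix (Fin 2) (Fin 2) ℝ)).det.eval t =
    (73 / 2500 + 437 / 500 * t ^ 7 - 19 / 10 * t ^ 8 + t ^ 9 + 287 / 10000000 * t ^ 16) *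
      (402 + 391 / 50 * t ^ 7 - 19 / 10 * t ^ 8 + 14 / 125 * t ^ 9 + 13 / 6250000000 * t ^ 16) -
      (161 / 100 * t ^ 8) * (161 / 100 * t ^ 8) := by
  unfold matPoly
  rw [Matrix.det_fin_two]
  simp [Matrix.sum_apply, Matrix.smul_apply, Fin.sum_univ_succ, Matrix.diagonal]
  ring

/-- **A degree-16 member of 𝕊 with `n = 2`, `α = 2` and `z⁺ ≥ 6`.**  Exponents `0, 7, 8, 9, 16`; the letters at
`0, 7, 9, 16` are positive definite diagonal, the letter at `8` is `−K` with `K = [[19/10, 161/100], [161/100, 19/10]]`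
positive definite; the determinant has at least six distinct positive roots (one in each of
`(9/10, 1), (1, 3/2), (3/2, 2), (2, 5), (5, 7), (7, 8)`), so `posEig ≥ 6` while `n · α = 4`. [data of this seat;
cite: CameronPsarrakos2019 §2 (class 𝕊, inequality (6))] -/
theorem exists_classS_degree16_six :
    ∃ (d : Fin 5 → ℕ) (A : Fin 5 → Matrix (Fin 2) (Fin 2) ℝ) (σ : Fin 5 → Bool),
      InClassS d A σ ∧ alternations σ = 2 ∧ d 4 = 16 ∧
      (∀ k, k ≠ 2 → ∃ v : Fin 2 → ℝ, A k = Matrix.diagonal v) ∧ (-A 2).PosDef ∧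
      6 ≤ ((matPoly d A).det.roots.filter (fun t => 0 < t)).toFinset.card ∧ 6 ≤ posEig d A := by
  -- positive definiteness of K
  have hK : (!![19 / 10, 161 / 100; 161 / 100, 19 / 10] : Matrix (Fin 2) (Fin 2) ℝ).PosDef := by
    refine Matrix.PosDef.of_dotProduct_mulVec_pos ?_ ?_
    · rw [Matrix.IsHermitian]
      ext i j
      fin_cases i <;> fin_cases j <;> simp
    · intro x hx
      have hx' : x 0 ≠ 0 ∨ x 1 ≠ 0 := by
        by_contra h
        push Not at h
        apply hx
        ext i
        fin_cases i <;> simp [h.1, h.2]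
      have hq : star x ⬝ᵥ ((!![19 / 10, 161 / 100; 161 / 100, 19 / 10] : Matrix (Fin 2) (Fin 2) ℝ) *ᵥ x)
          = (19 / 10 : ℝ) * x 0 * x 0 + 2 * (161 / 100 : ℝ) * x 0 * x 1 + (19 / 10 : ℝ) * x 1 * x 1 := by
        simp [Matrix.mulVec, dotProduct, Fin.sum_univ_two]
        ring
      rw [hq]
      rcases hx' with h0 | h1
      · have := sq_pos_of_ne_zero h0
        nlinarith [sq_nonneg (x 0 + x 1), sq_nonneg (x 0 - x 1), sq_nonneg (x 1)]
      · have := sq_pos_of_ne_zero h1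
        nlinarith [sq_nonneg (x 0 + x 1), sq_nonneg (x 0 - x 1), sq_nonneg (x 0)]
  refine ⟨![0, 7, 8, 9, 16],
    ![Matrix.diagonal ![73 / 2500, 402], Matrix.diagonal ![437 / 500, 391 / 50],
      -!![19 / 10, 161 / 100; 161 / 100, 19 / 10], Matrix.diagonal ![1, 14 / 125],
      Matrix.diagonal ![287 / 10000000, 13 / 6250000000]],
    ![true, true, false, true, true], ?_, by decide, rfl, ?_, by simpa using hK, ?_⟩
  · -- membership in 𝕊
    refine ⟨?_, ?_⟩
    · refine Fin.strictMono_iff_lt_succ.2 ?_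
      intro i
      fin_cases i <;> simp
    · intro k
      fin_cases k
      all_goals simp [Matrix.posDef_diagonal_iff, Fin.forall_fin_two, hK]
  · -- the four diagonal letters
    intro k hk
    fin_cases k
    · exact ⟨![73 / 2500, 402], by simp⟩
    · exact ⟨![437 / 500, 391 / 50], by simp⟩
    · exact absurd rfl hk
    · exact ⟨![1, 14 / 125], by simp⟩
    · exact ⟨![287 / 10000000, 13 / 6250000000], by simp⟩
  · -- six separated positive roots of the determinant
    set D : ℝ[X] := (matPoly (![0, 7, 8, 9, 16] : Fin 5 → ℕ)
      (![Matrix.diagonal ![73 / 2500, 402], Matrix.diagonal ![437 / 500, 391 / 50],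
         -!![19 / 10, 161 / 100; 161 / 100, 19 / 10], Matrix.diagonal ![1, 14 / 125],
         Matrix.diagonal ![287 / 10000000, 13 / 6250000000]] : Fin 5 → Matrix (Fin 2) (Fin 2) ℝ)).det with hD
    have hev : ∀ t : ℝ, D.eval t =
        (73 / 2500 + 437 / 500 * t ^ 7 - 19 / 10 * t ^ 8 + t ^ 9 + 287 / 10000000 * t ^ 16) *
          (402 + 391 / 50 * t ^ 7 - 19 / 10 * t ^ 8 + 14 / 125 * t ^ 9 + 13 / 6250000000 * t ^ 16) -
          (161 / 100 * t ^ 8) * (161 / 100 * t ^ 8) := by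
      intro t; rw [hD]; exact det_eval_witness16 t
    have s1 : 0 < D.eval (9 / 10 : ℝ) := by rw [hev]; norm_num
    have s2 : D.eval (1 : ℝ) < 0 := by rw [hev]; norm_num
    have s3 : 0 < D.eval (3 / 2 : ℝ) := by rw [hev]; norm_num
    have s4 : D.eval (2 : ℝ) < 0 := by rw [hev]; norm_num
    have s5 : 0 < D.eval (5 : ℝ) := by rw [hev]; norm_num
    have s6 : D.eval (7 : ℝ) < 0 := by rw [hev]; norm_num
    have s7 : 0 < D.eval (8 : ℝ) := by rw [hev]; norm_num
    have hD0 : D ≠ 0 := by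
      intro h; rw [h, eval_zero] at s1; exact lt_irrefl _ s1
    have hcont : ∀ a b : ℝ, ContinuousOn (fun x => D.eval x) (Set.Icc a b) := fun a b => D.continuous.continuousOn
    -- a root in each sign-change interval
    obtain ⟨r1, hr1, h1⟩ : ∃ r ∈ Set.Ioo (9 / 10 : ℝ) 1, D.IsRoot r :=
      intermediate_value_Ioo' (by norm_num) (hcont _ _) ⟨s2, s1⟩
    obtain ⟨r2, hr2, h2⟩ : ∃ r ∈ Set.Ioo (1 : ℝ) (3 / 2), D.IsRoot r :=
      intermediate_value_Ioo (by norm_num) (hcont _ _) ⟨s2, s3⟩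
    obtain ⟨r3, hr3, h3⟩ : ∃ r ∈ Set.Ioo (3 / 2 : ℝ) 2, D.IsRoot r :=
      intermediate_value_Ioo' (by norm_num) (hcont _ _) ⟨s4, s3⟩
    obtain ⟨r4, hr4, h4⟩ : ∃ r ∈ Set.Ioo (2 : ℝ) 5, D.IsRoot r :=
      intermediate_value_Ioo (by norm_num) (hcont _ _) ⟨s4, s5⟩
    obtain ⟨r5, hr5, h5⟩ : ∃ r ∈ Set.Ioo (5 : ℝ) 7, D.IsRoot r :=
      intermediate_value_Ioo' (by norm_num) (hcont _ _) ⟨s6, s5⟩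
    obtain ⟨r6, hr6, h6⟩ : ∃ r ∈ Set.Ioo (7 : ℝ) 8, D.IsRoot r :=
      intermediate_value_Ioo (by norm_num) (hcont _ _) ⟨s6, s7⟩
    let r : Fin 6 → ℝ := ![r1, r2, r3, r4, r5, r6]
    have h12 : r1 < r2 := lt_trans hr1.2 hr2.1
    have h23 : r2 < r3 := lt_trans hr2.2 hr3.1
    have h34 : r3 < r4 := lt_trans hr3.2 hr4.1
    have h45 : r4 < r5 := lt_trans hr4.2 hr5.1
    have h56 : r5 < r6 := lt_trans hr5.2 hr6.1
    have h0 : 0 < r1 := lt_trans (by norm_num) hr1.1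
    have hmono : StrictMono r := by
      refine Fin.strictMono_iff_lt_succ.2 ?_
      intro i
      fin_cases i
      · exact h12
      · exact h23
      · exact h34
      · exact h45
      · exact h56
    have hpos : ∀ i, 0 < r i := by
      intro i
      fin_cases i
      · exact h0
      · exact lt_trans h0 h12
      · exact lt_trans (lt_trans h0 h12) h23
      · exact lt_trans (lt_trans (lt_trans h0 h12) h23) h34
      · exact lt_trans (lt_trans (lt_trans (lt_trans h0 h12) h23) h34) h45
      · exact lt_trans (lt_trans (lt_trans (lt_trans (lt_trans h0 h12) h23) h34) h45) h56
    have hroot : ∀ i, D.IsRoot (r i) := by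
      intro i
      fin_cases i
      · exact h1
      · exact h2
      · exact h3
      · exact h4
      · exact h5
      · exact h6
    have hsub : Finset.univ.image r ⊆ (D.roots.filter (fun t => 0 < t)).toFinset := by
      intro t ht
      obtain ⟨i, _, rfl⟩ := Finset.mem_image.1 ht
      rw [Multiset.mem_toFinset, Multiset.mem_filter]
      exact ⟨(Polynomial.mem_roots hD0).2 (hroot i), hpos i⟩
    have hcard : (Finset.univ.image r).card = 6 := by
      rw [Finset.card_image_of_injective _ hmono.injective]
      simp
    have hfin : 6 ≤ (D.roots.filter (fun t => 0 < t)).toFinset.card := by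
      calc 6 = (Finset.univ.image r).card := hcard.symm
        _ ≤ (D.roots.filter (fun t => 0 < t)).toFinset.card := Finset.card_le_card hsub
    refine ⟨hfin, ?_⟩
    unfold posEig
    rw [← hD]
    exact le_trans hfin (Multiset.toFinset_card_le _)

/-- **The matrix sign rule `z⁺ ≤ n·α` fails at degree 16** (`n = 2`, `α = 2`, five letters, one honest negative
definite letter): a second refutation of [cite: CameronPsarrakos2019, §2/§5, inequality (6)] beside the tree's
`not_matrixDescartesRule` (degree 67); their Theorem 7 proves the rule for degree `≤ 3`, so the least failing degree
lies in `4 … 16`. -/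
theorem not_matrixDescartesRule_deg16 : ¬ MatrixDescartesRule := by
  intro h
  obtain ⟨d, A, σ, hS, hα, -, -, -, -, h6⟩ := exists_classS_degree16_six
  have h4 : posEig d A ≤ 2 * alternations σ := h 2 5 d A σ hS
  rw [hα] at h4
  omega

end Summit.ValiantsHypothesis.ValiantsHypothesis.Theorems.LacunarySymmetroidMatrixDescartes.SignRule
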